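import Summits.CriticalPhenomena.PercolationContinuityZ3.Theorems.PercNearOneGluingNoHeavyLowerTailFourCopyHubMaps
import Summits.CriticalPhenomena.PercolationContinuityZ3.Theorems.PercNearOneGluingNoHeavyLowerTailFourCopyHubRelax
import Summits.CriticalPhenomena.PercolationContinuityZ3.Theorems.PercNearOneGluingNoHeavyLowerTailFourCopyHubPack
import HarnessLib

/-!
# `NoHeavyLowerTail` (stmt-CriticalPhenomena-4575) — FOUR-copy switching certificates, III: HUB certificates as data,
# their real value, the kernel bound `V` (hub-factorised maximum over the relaxation) and its SOUNDNESS

Support file (prover prim-ineq-prove-3 gen 8; `--supports stmt-CriticalPhenomena-4575`).  No named facts, no sorries.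

A HUB certificate (`Cert`) consists of a class map `cls : Ty → ℕ` and a coarse class map `cls2 : Ty → ℕ` on the fifteen
four-terminal types, one-step programs `u → T` with a potential on (class of the output of copy `T`, classes of the two
idle copies), and two-step programs `u → T₁ ; v → T₂` with a potential on (classes of the two target outputs, coarse class
of the idle side copy), such that copy `3` (the hub) is a target of every two-step program; the programs of a side copy
read the OTHER side copy only through `cls2` (`P1.ev`, `P2.ev`).  Its real value at a four-tuple `x` is
`Sreal c τ x = Σ_q λ_q(read on the types of Φ_q x)`.

THE BOUND.  For source type `πX` and base types `t₁ t₂ t₃` of the target copies, `V c πX t₁ t₂ t₃` is the maximum over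
the hub copy's refined states `s₃ ∈ states πX t₃` (part II) of
`hubVal + sideVal 1 t₁ + sideVal 2 t₂`, where `sideVal T t` is a SUM over the free root letters `w` of the maximum over
the options `p ∈ opts πX t w` of the total potential of the programs whose side root lies in the block of `w` — given the
hub state, the two side copies and their `X`-blocks decouple, which is what makes `V` cheap for the kernel.
SOUNDNESS (`Sreal_le_V`): `Sreal c τ x ≤ V c (type x₀) (type x₁) (type x₂) (type x₃)` for every finite graph, every
placement `τ` of the four terminals and every four-tuple `x` (real outputs are admissible: part II; regrouping by fibres).
-/

noncomputable section

namespace Summit.CriticalPhenomena.PercolationContinuityZ3.Theorems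

namespace FourCopyHub

open Finset Literature.Probability.Percolation Literature.Probability.Percolation.DecisionTree
open Literature.Probability.Percolation.Gladkov ThreePointLB GroupThreePointLB FourPointAtoms SwitchRelax
open scoped Classical

/-! ### Certificates as data -/

/-- A one-step program `u → T` with its potential on (class of the output of copy `T`, classes of the two idle copies):
for a HUB program (`T = 3`) the idle arguments are the classes of copies `1, 2`; for a SIDE program (`T ∈ {1,2}`) they are
the coarse class of the other side copy and the class of the hub copy. [this work] -/
structure P1 where
  /-- root terminal -/
  u : Fin 4
  /-- target copy -/
  T : Fin 4
  /-- potential on (class of `o_T`, idle class 1, idle class 2) -/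
  lam : ℕ → ℕ → ℕ → ℤ

/-- A two-step program `u → T1 ; v → T2` with its potential on (class of `o_{T1}`, class of `o_{T2}`). [this work] -/
structure P2 where
  /-- first root terminal -/
  u : Fin 4
  /-- first target copy -/
  T1 : Fin 4
  /-- second root terminal -/
  v : Fin 4
  /-- second target copy -/
  T2 : Fin 4
  /-- potential on (class of first output, class of second output, coarse class of the idle side copy) -/
  lam : ℕ → ℕ → ℕ → ℤ

/-- A four-copy HUB certificate (hub = copy `3`). [this work] -/
structure Cert where
  /-- number of classes (classes are `< ncls`) -/
  ncls : ℕ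
  /-- class of a type (the potentials read classes) -/
  cls : Ty → ℕ
  /-- number of coarse classes (coarse classes are `< ncl2`) -/
  ncl2 : ℕ
  /-- coarse class of a type (read by the programs of a side copy on the OTHER side copy) -/
  cls2 : Ty → ℕ
  /-- one-step programs -/
  one : List P1
  /-- two-step programs -/
  two : List P2

/-- Well-formed one-step program: the target is not the source copy. [this work] -/
def P1.wf (q : P1) : Bool := decide (q.T ≠ 0)
/-- Well-formed two-step program: distinct non-source targets, one of them the hub. [this work] -/
def P2.wf (q : P2) : Bool := decide (q.T1 ≠ 0 ∧ q.T2 ≠ 0 ∧ q.T2 ≠ q.T1 ∧ (q.T1 = 3 ∨ q.T2 = 3))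
/-- Weakly well-formed two-step program: distinct non-source targets (any pair). [this work] -/
def P2.wfT (q : P2) : Bool := decide (q.T1 ≠ 0 ∧ q.T2 ≠ 0 ∧ q.T2 ≠ q.T1)
/-- Well-formed certificate. [this work] -/
def Cert.wf (c : Cert) : Bool := c.one.all P1.wf && c.two.all P2.wf
/-- Weakly well-formed certificate (two-step programs on any pair of target copies). [this work] -/
def Cert.wfT (c : Cert) : Bool := c.one.all P1.wf && c.two.all P2.wfT

/-- The program of part I underlying a one-step program. [this work] -/
def P1.prog (q : P1) : Prog := ⟨false, q.u, q.T, 0, 0⟩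
/-- The program of part I underlying a two-step program. [this work] -/
def P2.prog (q : P2) : Prog := ⟨true, q.u, q.T1, q.v, q.T2⟩

/-! ### The real value -/

/-- The other side copy of a side program with target `T ∈ {1,2}`. [this work] -/
def oth (T : Fin 4) : Fin 4 := if T = 1 then 2 else 1
/-- The idle copy of a two-step program: the copy in `{1,2,3}` that is not a target. [this work] -/
def P2.idl (q : P2) : Fin 4 := if q.T1 ≠ 1 ∧ q.T2 ≠ 1 then 1 else if q.T1 ≠ 2 ∧ q.T2 ≠ 2 then 2 else 3

/-- The potential of a one-step program read on a tuple of types: a hub program (`T = 3`) reads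
`λ(cls t₃; cls t₁, cls t₂)`, a side program reads `λ(cls t_T; cls2 t_{T'}, cls t₃)` (`T'` the other side). [this work] -/
def P1.ev (c : Cert) (q : P1) (t : Fin 4 → Ty) : ℤ :=
  if q.T = 3 then q.lam (c.cls (t 3)) (c.cls (t 1)) (c.cls (t 2)) else q.lam (c.cls (t q.T)) (c.cls2 (t (oth q.T))) (c.cls (t 3))
/-- The potential of a two-step program read on a tuple of types: `λ(cls t_{T1}, cls t_{T2}; cls2 t_idle)`. [this work] -/
def P2.ev (c : Cert) (q : P2) (t : Fin 4 → Ty) : ℤ := q.lam (c.cls (t q.T1)) (c.cls (t q.T2)) (c.cls2 (t q.idl))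

section Real

variable {V : Type*} [Fintype V] [DecidableEq V] (τ : Fin 4 → V)

/-- Value of a one-step program at `x`: its potential read on the types of the output tuple. [this work] -/
def P1.val (c : Cert) (q : P1) (x : Fin 4 → Finset (Sym2 V)) : ℤ := q.ev c fun j => ftype τ (q.prog.out τ x j)
/-- Value of a two-step program at `x`. [this work] -/
def P2.val (c : Cert) (q : P2) (x : Fin 4 → Finset (Sym2 V)) : ℤ := q.ev c fun j => ftype τ (q.prog.out τ x j)
/-- **The real value** `S(x) = Σ_q λ_q(classes of the target outputs of Φ_q x)`. [this work] -/
def Sreal (c : Cert) (x : Fin 4 → Finset (Sym2 V)) : ℤ :=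
  (c.one.map fun q => q.val τ c x).sum + (c.two.map fun q => q.val τ c x).sum

end Real

/-! ### Packed vectors (see `…FourCopyHubPack`) -/

/-- The packed `p`-vector of an integer table on types: digit `p` stores `enc (f p) = (f p + OFF)⁺`. [this work] -/
def pvec (f : Ty → ℤ) : ℕ := pvecN fun p => enc (f p)

/-! ### Per-source-type tables -/

/-- Classes of the admissible clean outputs of a first step rooted at `u`, option `p` (without repetitions). [this work] -/
def cleanC (c : Cert) (πX : Ty) (u : Fin 4) (p : Ty) : List ℕ := ((cleanL πX u p).map c.cls).dedup
/-- Classes of the admissible messy outputs of a second step rooted at `v` after `u` (copy of base type `t`, option `p`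
for `v`; without repetitions). [this work] -/
def messyC (c : Cert) (πX : Ty) (u v : Fin 4) (t p : Ty) : List ℕ := ((messyL πX u v t p).map c.cls).dedup
/-- Is `p` a relevant option for root letter `u` (root-block rule)? [this work] -/
def relB (πX : Ty) (u : Fin 4) (p : Ty) : Bool := rootOK πX {u} p

/-- Best value of a (clean classes, messy classes) pair of option lists under a pair potential. [this work] -/
def e2T (lam : ℕ → ℕ → ℤ) (C M : List ℕ) : ℤ := lmax (C.flatMap fun cf => M.map fun cs => lam cf cs)

/-- Tables depending on the source type only: clean classes `[u][p]`, messy classes `[u][v][t][p]` (relevant `p` only),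
relevance `[u][p]`, options `[t][w]`, and the packed tables of the one-step and hub-first programs. [this work] -/
structure PiTabs where
  /-- `cleanC` by `[u][p]` -/
  CT : List (List (List ℕ))
  /-- `messyC` by `[u][v][t][p]`, `[]` at irrelevant `p` -/
  MT : List (List (List (List (List ℕ))))
  /-- `relB` by `[u][p]` -/
  RB : List (List Bool)
  /-- `optsF` by `[t][w]` -/
  OT : List (List (List Ty))
  /-- one-step programs: `(q, rep u)` -/
  P1s : List (P1 × Fin 4)
  /-- two-step programs: `(q, XHF q by coarse idle class or [], rep u, rep v)` -/
  P2s : List (P2 × List (List ℕ) × Fin 4 × Fin 4)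

/-- Lookups. [this work] -/
def PiTabs.clean (P : PiTabs) (u : Fin 4) (p : Ty) : List ℕ := lk (lk P.CT u.val []) p.val []
/-- Lookups. [this work] -/
def PiTabs.messy (P : PiTabs) (u v : Fin 4) (t p : Ty) : List ℕ := lk (lk (lk (lk P.MT u.val []) v.val []) t.val []) p.val []
/-- Lookups. [this work] -/
def PiTabs.relv (P : PiTabs) (u : Fin 4) (p : Ty) : Bool := lk (lk P.RB u.val []) p.val false
/-- Lookups. [this work] -/
def PiTabs.opts (P : PiTabs) (t : Ty) (w : Fin 4) : List Ty := lk (lk P.OT t.val []) w.val []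

/-- Packed tables of a HUB one-step program: entry `[ncls * a + b]` is the `p`-vector
`p ↦ enc (best clean value at option p, idle classes a, b)`. [this work] -/
def x1hub (CT : List (List (List ℕ))) (ncls : ℕ) (q : P1) : List ℕ :=
  (List.range (ncls * ncls)).map fun i => pvec fun p => lmax ((lk (lk CT q.u.val []) p.val []).map fun o => q.lam o (i / ncls) (i % ncls))
/-- Packed tables of a SIDE one-step program for hub class `b`: entry `[a]` (coarse class of the other side) is the
`p`-vector `p ↦ enc (best clean value at option p, a, b)`. [this work] -/
def x1side (CT : List (List (List ℕ))) (ncl2 b : ℕ) (q : P1) : List ℕ :=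
  (List.range ncl2).map fun a => pvec fun p => lmax ((lk (lk CT q.u.val []) p.val []).map fun o => q.lam o a b)

/-- Tables of a hub-first program (`T1 = 3`): entry `[a][pu]` (`a` the coarse class of the idle side) is the packed ROW
(base `BV`, block `tT`) of the packed `p`-vectors `p ↦ enc (e2 (clean u pu) (messy u v tT p); a)` (relevant `pu`, `p`
only; `0` at irrelevant `pu`). [this work] -/
def xhfOf (CT : List (List (List ℕ))) (MT : List (List (List (List (List ℕ))))) (RB : List (List Bool)) (ncl2 : ℕ) (q : P2) :
    List (List ℕ) :=
  (List.range ncl2).map fun a => allTys.map fun pu =>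
    if lk (lk RB q.u.val []) pu.val false then
      packL BV (allTys.map fun tT => pvec fun p =>
        if lk (lk RB q.v.val []) p.val false then
          e2T (fun cf cs => q.lam cf cs a) (lk (lk CT q.u.val []) pu.val [])
            (lk (lk (lk (lk MT q.u.val []) q.v.val []) tT.val []) p.val [])
        else bot)
    else 0

/-- Relevance table `[u][p]`. [this work] -/
def RBtab (πX : Ty) : List (List Bool) := (List.finRange 4).map fun u => allTys.map fun p => relB πX u p
/-- Clean-class table `[u][p]`. [this work] -/
def CTab (c : Cert) (πX : Ty) : List (List (List ℕ)) := (List.finRange 4).map fun u => allTys.map fun p => cleanC c πX u p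
/-- Messy-class table `[u][v][t][p]` (relevant `p` only). [this work] -/
def MTab (c : Cert) (πX : Ty) : List (List (List (List (List ℕ)))) :=
  (List.finRange 4).map fun u => (List.finRange 4).map fun v => allTys.map fun t => allTys.map fun p =>
    if relB πX v p then messyC c πX u v t p else []

/-- Best value of a one-step program when its target copy has option `p` for the root and the idle classes are `a, b`.
[this work] -/
def e1 (c : Cert) (πX : Ty) (q : P1) (p : Ty) (a b : ℕ) : ℤ := lmax ((cleanC c πX q.u p).map fun o => q.lam o a b)
/-- Best value of a two-step program: first output clean (option `p₁` for `u`), second output messy (copy of base type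
`t₂`, option `p₂` for `v`), idle coarse class `a`. [this work] -/
def e2 (c : Cert) (πX : Ty) (q : P2) (p₁ t₂ p₂ : Ty) (a : ℕ) : ℤ :=
  e2T (fun cf cs => q.lam cf cs a) (cleanC c πX q.u p₁) (messyC c πX q.u q.v t₂ p₂)
/-- Guarded entry: `e2` at relevant options, `bot` otherwise (never read). [this work] -/
def e2g (c : Cert) (πX : Ty) (q : P2) (p₁ t₂ p₂ : Ty) (a : ℕ) : ℤ :=
  if relB πX q.u p₁ && relB πX q.v p₂ then e2 c πX q p₁ t₂ p₂ a else bot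
/-- The hub-first tables of a program in specification form. [this work] -/
def xhfT (c : Cert) (πX : Ty) (q : P2) : List (List ℕ) :=
  if q.T1 = 3 then
    (List.range c.ncl2).map fun a => allTys.map fun pu =>
      if relB πX q.u pu then packL BV (allTys.map fun tT => pvec fun p => e2g c πX q pu tT p a) else 0
  else []

/-- The tables of a source type. [this work] -/
def mkPiTabs (c : Cert) (πX : Ty) : PiTabs where
  CT := CTab c πX
  MT := MTab c πX
  RB := RBtab πX
  OT := allTys.map fun t => (List.finRange 4).map fun w => optsF πX t w
  P1s := c.one.map fun q => (q, rep πX q.u)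
  P2s := c.two.map fun q =>
    (q, (if q.T1 = 3 then xhfOf (CTab c πX) (MTab c πX) (RBtab πX) c.ncl2 q else []), rep πX q.u, rep πX q.v)

/-! ### Per-slice tables (hub base type `t₃`) -/

/-- Tables of a side-first program (`T2 = 3`) for hub base type `t3`: entry `[a][pv]` (`a` the coarse class of the idle
side, `pv` the hub option for `v`) is the packed `p`-vector `p ↦ enc (e2 (clean u p) (messy u v t3 pv); a)` (`0` at
irrelevant `pv`). [this work] -/
def xsfOf (P : PiTabs) (ncl2 : ℕ) (t3 : Ty) (q : P2) : List (List ℕ) :=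
  (List.range ncl2).map fun a => allTys.map fun pv =>
    if P.relv q.v pv then
      pvec fun p => if P.relv q.u p then e2T (fun cf cs => q.lam cf cs a) (P.clean q.u p) (P.messy q.u q.v t3 pv) else bot
    else 0

/-- A fibre `(T, w)`: packed tables of its one-step programs, of its side-first programs (with the representative of the
hub root), of its hub-first programs (with the representative of the hub root) — each indexed first by the coarse class
`a` of the other side copy. [this work] -/
structure Fib where
  /-- tables `[a]` of the one-step programs `u → T`, `rep u = w` -/
  one : List (List ℕ)
  /-- `(XSF tables [a][hub option], rep v)` of the side-first programs `u → T ; v → 3`, `rep u = w` -/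
  sf : List (List (List ℕ) × Fin 4)
  /-- `(XHF rows [a][hub option], rep u)` of the hub-first programs `u → 3 ; v → T`, `rep v = w` -/
  hf : List (List (List ℕ) × Fin 4)

/-- Number of programs in a fibre. [this work] -/
def Fib.size (F : Fib) : ℕ := F.one.length + F.sf.length + F.hf.length

/-- The tables of a slice `(πX, t₃)`. [this work] -/
structure Slice where
  /-- number of classes -/
  nc : ℕ
  /-- number of coarse classes -/
  n2 : ℕ
  /-- option POSITIONS by `[w][t]`: the values `p.val` of the options `optsF πX t w` -/
  OP : List (List (List ℕ))
  /-- hub one-step programs: `(tables [a * ncls + b], rep u)` -/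
  hub : List (List ℕ × Fin 4)
  /-- fibres of side copy 1 by `w` -/
  F1 : List Fib
  /-- fibres of side copy 2 by `w` -/
  F2 : List Fib

/-- The fibre `(T, w)` of the slice of hub base type `t3`. [this work] -/
def mkFib (c : Cert) (P : PiTabs) (t3 : Ty) (T w : Fin 4) : Fib where
  one := (P.P1s.filter fun e => e.1.T = T ∧ e.2 = w).map fun e => x1side P.CT c.ncl2 (c.cls t3) e.1
  sf := (P.P2s.filter fun e => e.1.T2 = 3 ∧ e.1.T1 = T ∧ e.2.2.1 = w).map fun e => (xsfOf P c.ncl2 t3 e.1, e.2.2.2)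
  hf := (P.P2s.filter fun e => e.1.T1 = 3 ∧ e.1.T2 = T ∧ e.2.2.2 = w).map fun e => (e.2.1, e.2.2.1)

/-- The tables of a slice. [this work] -/
def mkSlice (c : Cert) (P : PiTabs) (t3 : Ty) : Slice where
  nc := c.ncls
  n2 := c.ncl2
  OP := (List.finRange 4).map fun w => allTys.map fun t => (P.opts t w).map fun p => p.val
  hub := (P.P1s.filter fun e => e.1.T = 3).map fun e => (x1hub P.CT c.ncls e.1, e.2)
  F1 := (List.finRange 4).map fun w => mkFib c P t3 1 w
  F2 := (List.finRange 4).map fun w => mkFib c P t3 2 w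

/-! ### The per-state evaluation -/

/-- Hub values by `[a][b]` (`a, b` the classes of the side base types), decoded: `Σ (value + OFF) − (#hub)·OFF` over the
hub one-step programs. [this work] -/
def Slice.hubT (S : Slice) (s3 : St4) : List (List ℤ) :=
  (List.range S.nc).map fun a => (List.range S.nc).map fun b =>
    (((S.hub.map fun e => digW (lk e.1 (S.nc * a + b) 0) (s3 e.2).val).sum : ℕ) : ℤ) - S.hub.length * OFF

/-- The columns of fibre `F` at hub state `s3` (option positions `OPw` of its letter, by side base type), by
`[a][tT]` (`a` the coarse class of the other side, `tT` the side base type): the best stored fibre value over the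
options.  The `tT`-independent part of the packed vector is formed once per `a`; the hub-first programs' packed rows at
the hub option are added as numbers and block `tT` is read off. [this work] -/
def Fib.col (F : Fib) (n2 : ℕ) (OPw : List (List ℕ)) (s3 : St4) : List (List ℕ) :=
  (List.range n2).map fun a =>
    let base := (F.one.map fun e => lk e a 0).sum + (F.sf.map fun e => lk (lk e.1 a []) (s3 e.2).val 0).sum
    let tot := (F.hf.map fun e => lk (lk e.1 a []) (s3 e.2).val 0).sum
    (allTys.zip OPw).map fun tp => nmax (tp.2.map fun p => digW (base + digV tot tp.1.val) p)

/-- Decoded columns: `best stored − size·OFF`, as integers. [this work] -/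
def Fib.colZ (F : Fib) (n2 : ℕ) (OPw : List (List ℕ)) (s3 : St4) : List (List ℤ) :=
  (F.col n2 OPw s3).map fun col => col.map fun n : ℕ => (↑n : ℤ) - F.size * OFF

/-- Side values of a side copy (fibres `FS` by letter), by `[a][t]`: elementwise sum of the decoded columns. [this work] -/
def Slice.sideL (S : Slice) (FS : List Fib) (s3 : St4) : List (List ℤ) :=
  (List.zipWith (fun F OPw => F.colZ S.n2 OPw s3) FS S.OP).foldr
    (fun r acc => List.zipWith (fun r1 a1 => List.zipWith (· + ·) r1 a1) r acc) (List.replicate S.n2 (List.replicate 15 0))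

/-- The row of a hub state: hub values by `[cls t₁][cls t₂]`, side-1 values TRANSPOSED by `[t₁][cls2 t₂]`, side-2 values
by `[cls2 t₁][t₂]`. [this work] -/
def Slice.row (S : Slice) (s3 : St4) : List (List ℤ) × (List (List ℤ) × List (List ℤ)) :=
  let S1 := S.sideL S.F1 s3
  (S.hubT s3, (allTys.map fun t => S1.map fun r => lk r t.val bot, S.sideL S.F2 s3))

/-- Entry of a row at `(t₁, t₂)`: the programs of side copy `1` read copy `2` through `cls2 t₂` and vice versa.
[this work] -/
def rowAt (c : Cert) (r : List (List ℤ) × (List (List ℤ) × List (List ℤ))) (t1 t2 : Ty) : ℤ :=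
  lk (lk r.1 (c.cls t1) []) (c.cls t2) bot + lk (lk r.2.1 t1.val []) (c.cls2 t2) bot + lk (lk r.2.2 (c.cls2 t1) []) t2.val bot

/-- The constant of a chunk: for each `t₁`, `(t₁, cls t₁, cls2 t₁, [(t₂, cls t₂, cls2 t₂, B t₁ t₂ t₃)])`. [this work] -/
def mkK (c : Cert) (B : Ty → Ty → Ty → ℤ) (t3 : Ty) : List (Ty × ℕ × ℕ × List (Ty × ℕ × ℕ × ℤ)) :=
  allTys.map fun t1 => (t1, c.cls t1, c.cls2 t1, allTys.map fun t2 => (t2, c.cls t2, c.cls2 t2, B t1 t2 t3))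

/-- The test of one row against the chunk constant: every entry `≤ B`, walking the tables in order. [this work] -/
def rowOK (K : List (Ty × ℕ × ℕ × List (Ty × ℕ × ℕ × ℤ))) (r : List (List ℤ) × (List (List ℤ) × List (List ℤ))) : Bool :=
  K.all fun e =>
    let hubrow := lk r.1 e.2.1 []
    let u := lk r.2.1 e.1.val []
    let s2row := lk r.2.2 e.2.2.1 []
    e.2.2.2.all fun f => decide (lk hubrow f.2.1 bot + lk u f.2.2.1 bot + lk s2row f.1.val bot ≤ f.2.2.2)

/-- **The kernel check of a source type** `πX` on the chunks `(t₃, lo, n)` (hub states of base type `t₃` at positions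
`[lo, lo+n)`): the source-type tables are built once, the chunk constant once per chunk; every row passes `rowOK`.
[this work] -/
def piCheck (c : Cert) (B : Ty → Ty → Ty → ℤ) (πX : Ty) (chunks : List (Ty × ℕ × ℕ)) : Bool :=
  let P := mkPiTabs c πX
  chunks.all fun ch =>
    let S := mkSlice c P ch.1
    let K := mkK c B ch.1
    (((states πX ch.1).drop ch.2.1).take ch.2.2).all fun s3 => rowOK K (S.row s3)

/-- Coverage of the hub states of every base type by the chunks. [this work] -/
def covers (πX : Ty) (chunks : List (Ty × ℕ × ℕ)) : Bool :=
  allTys.all fun t3 => (List.range (states πX t3).length).all fun i =>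
    chunks.any fun ch => decide (ch.1 = t3 ∧ ch.2.1 ≤ i ∧ i < ch.2.1 + ch.2.2)

/-- The candidate value of a hub state (this is what `piCheck` bounds). [this work] -/
def candT (c : Cert) (πX t1 t2 t3 : Ty) (s3 : St4) : ℤ := rowAt c ((mkSlice c (mkPiTabs c πX) t3).row s3) t1 t2

/-- **THE BOUND** `V(πX, t₁, t₂, t₃)`: maximum of the candidate values over the hub states. [this work] -/
def V (c : Cert) (πX t1 t2 t3 : Ty) : ℤ := lmax ((states πX t3).map fun s3 => candT c πX t1 t2 t3 s3)

end FourCopyHub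

end Summit.CriticalPhenomena.PercolationContinuityZ3.Theorems

end
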